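import Mathlib
import HarnessLib
import Summits.HubbardSuperconductivity.HubbardSuperconductivity.Theorems.KLProgrammeKLRegimeEnginePairTransferMemberTwoShell
import Summits.HubbardSuperconductivity.HubbardSuperconductivity.Theorems.KLProgrammeKLRegimeEnginePairTransferDLineRoomReading

/-!
# Route `KLProgramme` — ENGINE item stmt-HubbardSuperconductivity-20437 `KLRegimeEngineV17F2`, class-#5 STEP (X).3: THE MEMBER PH MASS ABOVE THE TRANSFER
# THRESHOLD IN THE SLOTS' CURRENCY — `(Λₙ−Λₙ₊₁)(βL²)⁻³·Wd_j ≤ C·A·(10 + 50Gβ/L)·(16384·G²·min(|x−y|_𝕋/Λₙ₊₁, Λₙ₊₁/|x−y|_𝕋) + (√2/4)·2⁻ⁿ)` for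
# `G·|x−y|_𝕋 ≥ Λₙ₊₁/8` (the complement of the signed rows' small-transfer regime) (cell gate-hubbard-kl, seat hubbard-kl-k3c2-p2 g17)

Reading of `Wd_member_sum_le_twoShell` (…MemberTwoShell) in the style of `WDd_row_le_slots` (…DLineRoomReading, gen 16): the two-shell factor at `(2Λ(t) + Gδ)` is read
with `twoShell_factor_le_slots` at `(Λ, Λ₁, κ) = (2Λ(t), 2Λₙ₊₁, 64)` and `min(r/(2Λₙ₊₁), 2Λₙ₊₁/r) ≤ 2·min(r/Λₙ₊₁, Λₙ₊₁/r)` (`min_double_le`), the bracket with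
`bracket_le` at `Λ′ = Λ(t)`, the prefactor with `prefactor_eq` / `ratio_le_sixteen` (`Λ(t)/Λₙ ≤ 1`).  Together with `klms_memberPH_direct_signed_le` (small transfer)
the member direct class has a slot-shaped supply at EVERY transfer.  Arithmetic only; nothing about the model is asserted.
-/

noncomputable section

namespace Summit.HubbardSuperconductivity.HubbardSuperconductivity.Theorems.KLRegimeSplit

set_option linter.dupNamespace false -- summit = problem name (single-conjunct summit), D-0017

open Real Finset Set Literature.MathematicalPhysics.QuantumLattice Literature.Probability.LatticeModels
open Literature.MathematicalPhysics.QuantumLattice.FermiRG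
open Summit.HubbardSuperconductivity.HubbardSuperconductivity.Theorems.KLProgrammeLegKernels
open Summit.HubbardSuperconductivity.HubbardSuperconductivity.Theorems.TwoPointAssembly
open Summit.HubbardSuperconductivity.HubbardSuperconductivity.Theorems.DispersionFlow
open Summit.HubbardSuperconductivity.HubbardSuperconductivity.Theorems.KLRegimeWick
open Summit.HubbardSuperconductivity.HubbardSuperconductivity.Theorems.EngineV8
open Summit.HubbardSuperconductivity.HubbardSuperconductivity.Theorems.PerturbedFermiCurve

/-- `min(r/(2Λ₁), 2Λ₁/r) ≤ 2·min(r/Λ₁, Λ₁/r)` (`0 < Λ₁`, `0 < r`). -/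
theorem min_double_le {r Λ₁ : ℝ} (hΛ₁ : 0 < Λ₁) (hr : 0 < r) : min (r / (2 * Λ₁)) (2 * Λ₁ / r) ≤ 2 * min (r / Λ₁) (Λ₁ / r) := by
  rcases le_total r Λ₁ with h | h
  · have hm : min (r / Λ₁) (Λ₁ / r) = r / Λ₁ := min_eq_left (by rw [div_le_div_iff₀ hΛ₁ hr]; nlinarith)
    rw [hm]
    refine (min_le_left _ _).trans ?_
    rw [div_le_iff₀ (by positivity)]
    have : r / Λ₁ * (2 * Λ₁) = 2 * r := by field_simp
    nlinarith [div_nonneg hr.le hΛ₁.le]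
  · have hm : min (r / Λ₁) (Λ₁ / r) = Λ₁ / r := min_eq_right (by rw [div_le_div_iff₀ hr hΛ₁]; nlinarith)
    rw [hm]
    refine (min_le_right _ _).trans (le_of_eq ?_)
    ring

/-- **THE MEMBER DIRECT PH MASS IN THE SLOTS' CURRENCY ABOVE THE TRANSFER THRESHOLD.**  For `TwoShellFrameAreaAt A u`, `R.WF2`, `0 < U ≤ u R`, `μ ∈ klWindowC`,
`FrameOK R U N μ K`, `0 < β`, `n+1 ≤ j`, `π/(4β) ≤ Λₙ₊₁`, `t ∈ [0,1]`, `Gδ ≤ Λₙ₊₁`, `2Λₙ + Gδ ≤ klE0` and `Λₙ₊₁/8 ≤ G·|x−y|_𝕋`: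
`(Λₙ−Λₙ₊₁)((βL²)³)⁻¹·(member direct mass) ≤ (512/3)(27/8π²)·A·(16/π)·(10 + 50Gβ/L)·(16384·G²·min(|x−y|_𝕋/Λₙ₊₁, Λₙ₊₁/|x−y|_𝕋) + (√2/4)·2⁻ⁿ)`. -/
theorem Wd_member_row_le_slots {L M : ℕ} [NeZero L] [NeZero M] (β μ : ℝ) (K : TrigPolyC4v) {A : ℝ} {u : RenConsts → ℝ} (h : TwoShellFrameAreaAt A u)
    (hA : 0 ≤ A) {R : RenConsts} (hR : R.WF2) {U : ℝ} (hU : 0 < U) (hUu : U ≤ u R) (hμ : μ ∈ klWindowC) {N : ℕ} (hK : FrameOK R U N μ K)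
    (hβ : 0 < β) (n : ℕ) {j : ℕ} (hj : n + 1 ≤ j) (hj'β : π / (4 * β) ≤ klScale klE0 (n + 1)) {t : ℝ} (ht : t ∈ Icc (0 : ℝ) 1)
    (hGδ : (4 + 8 / 3 * R.Gfr 1 * U ^ 2) * (2 * π / L) ≤ klScale klE0 (n + 1))
    (hE0 : 2 * klScale klE0 n + (4 + 8 / 3 * R.Gfr 1 * U ^ 2) * (2 * π / L) ≤ klE0) {x y : TorusSite 2 L}
    (hlarge : klScale klE0 (n + 1) / 8 ≤ (4 + 8 / 3 * R.Gfr 1 * U ^ 2) * klTorusNorm L (x - y)) :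
    (klScale klE0 n - klScale klE0 (n + 1)) * ((β * (L : ℝ) ^ 2) ^ 3)⁻¹ *
      ∑ p : FreqMomentum L M, ∑ _σ : Fin 2, ∑ p' : FreqMomentum L M,
        (if matsubaraInt M p'.1 + matsubaraInt M (omega0 M) = matsubaraInt M p.1 + matsubaraInt M (omega0 M) ∧ p'.2 = p.2 + x - y then
          ‖((((softSymbolCompl L M β μ K (n + 1) j p + (hubbardCutoffWeightCT L M β μ K (klScale klE0 (n + 1)) p -
                hubbardCutoffWeightCT L M β μ K (klScale klE0 n + t * (klScale klE0 (n + 1) - klScale klE0 n)) p) : ℝ)) : ℂ) *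
                (((β * (L : ℝ) ^ 2 : ℝ) : ℂ) * propCT L M β μ K p)) *
              ((((deriv (fun Λ' : ℝ => hubbardCutoffWeightCT L M β μ K Λ' p') (klScale klE0 n + t * (klScale klE0 (n + 1) - klScale klE0 n)) : ℝ)) : ℂ) *
                (((β * (L : ℝ) ^ 2 : ℝ) : ℂ) * propCT L M β μ K p')) +
            ((((deriv (fun Λ' : ℝ => hubbardCutoffWeightCT L M β μ K Λ' p) (klScale klE0 n + t * (klScale klE0 (n + 1) - klScale klE0 n)) : ℝ)) : ℂ) *
                (((β * (L : ℝ) ^ 2 : ℝ) : ℂ) * propCT L M β μ K p)) *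
              ((((softSymbolCompl L M β μ K (n + 1) j p' + (hubbardCutoffWeightCT L M β μ K (klScale klE0 (n + 1)) p' -
                hubbardCutoffWeightCT L M β μ K (klScale klE0 n + t * (klScale klE0 (n + 1) - klScale klE0 n)) p') : ℝ)) : ℂ) *
                (((β * (L : ℝ) ^ 2 : ℝ) : ℂ) * propCT L M β μ K p'))‖
        else 0) ≤
      512 / 3 * (27 / (8 * π ^ 2)) * A * (16 / π) * (10 + 50 * (4 + 8 / 3 * R.Gfr 1 * U ^ 2) * β / L) *
        (16384 * (4 + 8 / 3 * R.Gfr 1 * U ^ 2) ^ 2 * min (klTorusNorm L (x - y) / klScale klE0 (n + 1)) (klScale klE0 (n + 1) / klTorusNorm L (x - y)) +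
          Real.sqrt 2 / 4 * ((2 : ℝ) ^ n)⁻¹) := by
  have hπ := Real.pi_pos
  have hL : (0 : ℝ) < L := by exact_mod_cast Nat.pos_of_ne_zero (NeZero.ne L)
  have hGfr : ∀ j, 0 ≤ R.Gfr j := hR.wf.2.2
  set G : ℝ := 4 + 8 / 3 * R.Gfr 1 * U ^ 2 with hG
  have hG4 : 4 ≤ G := by rw [hG]; nlinarith [hGfr 1, sq_nonneg U]
  have hG0 : 0 ≤ G := by linarith
  set Λ : ℝ := klScale klE0 n + t * (klScale klE0 (n + 1) - klScale klE0 n) with hΛdef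
  have hΛ : 0 < Λ := scaleAt_pos n ht
  obtain ⟨hΛlo, hΛhi⟩ := scaleAt_mem n ht
  rw [← hΛdef] at hΛlo hΛhi
  have hΛn := klth_klScale_pos n
  have hΛ1 := klth_klScale_pos (n + 1)
  have hsucc : klScale klE0 (n + 1) = klScale klE0 n / 4 := klth_klScale_succ n
  set r : ℝ := klTorusNorm L (x - y) with hr
  have hrpos : 0 < r := by
    by_contra h0; push Not at h0
    have : G * r ≤ 0 := mul_nonpos_of_nonneg_of_nonpos hG0 h0
    linarith
  set mn : ℝ := min (r / klScale klE0 (n + 1)) (klScale klE0 (n + 1) / r) with hmn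
  have hmn0 : 0 ≤ mn := le_min (by positivity) (by positivity)
  have hbound := Wd_member_sum_le_twoShell (L := L) (M := M) β μ K h hA hR hU hUu hμ hK hβ n hj ht hE0 hrpos (le_refl r)
  rw [← hΛdef] at hbound
  -- the two-shell factor at `(2Λ, 2Λₙ₊₁, κ = 64)`
  have hX := twoShell_factor_le_slots (Λ := 2 * Λ) (Λ₁ := 2 * klScale klE0 (n + 1)) (r := r) (e := G * (2 * π / L)) (κ := 64) (by positivity)
    (by linarith) (by rw [hsucc]; linarith) hG4 (by norm_num) (by linarith) (by linarith)
  have hX' : (2 * Λ + G * (2 * π / L)) / r + Real.sqrt (2 * Λ + G * (2 * π / L)) ≤ 16384 * G ^ 2 * mn + Real.sqrt 2 / 4 * ((2 : ℝ) ^ n)⁻¹ := by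
    refine hX.trans (add_le_add ?_ ?_)
    · have hmd := min_double_le hΛ1 hrpos
      rw [hmn]
      nlinarith [sq_nonneg G, mul_nonneg (mul_nonneg (by norm_num : (0:ℝ) ≤ 2 * 64 ^ 2) (sq_nonneg G)) (le_min (by positivity : 0 ≤ r / (2 * klScale klE0 (n + 1))) (by positivity : 0 ≤ 2 * klScale klE0 (n + 1) / r))]
    · have h4 : Real.sqrt (2 * (2 * Λ)) ≤ Real.sqrt (2 * (2 * klScale klE0 n)) := Real.sqrt_le_sqrt (by linarith)
      have e : Real.sqrt (2 * (2 * klScale klE0 n)) = Real.sqrt 2 * Real.sqrt (2 * klScale klE0 n) := by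
        rw [← Real.sqrt_mul (by norm_num : (0:ℝ) ≤ 2)]
      rw [e, sqrt_two_mul_klScale_eq n] at h4
      linarith
  have hB := bracket_le (Λ' := Λ) hβ hL hG0 (hj'β.trans hΛlo)
  have hXnn : 0 ≤ (2 * Λ + G * (2 * π / L)) / r + Real.sqrt (2 * Λ + G * (2 * π / L)) := by positivity
  have hBnn : 0 ≤ β * Λ / π * (10 + 2 * G * β / L) + 12 * G * β / L := by positivity
  have hpre : 0 ≤ (klScale klE0 n - klScale klE0 (n + 1)) * ((β * (L : ℝ) ^ 2) ^ 3)⁻¹ := by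
    rw [hsucc]; have : 0 ≤ klScale klE0 n - klScale klE0 n / 4 := by linarith
    positivity
  refine (mul_le_mul_of_nonneg_left hbound hpre).trans ?_
  rw [hsucc, prefactor_eq hβ hL hΛ]
  have hratio : klScale klE0 n / (β * Λ ^ 2) * (β * Λ / π) ≤ 16 * (Λ / klScale klE0 n) / π :=
    ratio_le_sixteen hΛn hΛ hβ hΛ (by rw [hsucc] at hΛlo; exact hΛlo)
  have hq1 : Λ / klScale klE0 n ≤ 1 := by rw [div_le_one hΛn]; exact hΛhi
  calc 512 / 3 * (27 / (8 * π ^ 2)) * A * (klScale klE0 n / (β * Λ ^ 2)) *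
        ((2 * Λ + G * (2 * π / L)) / r + Real.sqrt (2 * Λ + G * (2 * π / L))) *
        (β * Λ / π * (10 + 2 * G * β / L) + 12 * G * β / L)
      ≤ 512 / 3 * (27 / (8 * π ^ 2)) * A * (klScale klE0 n / (β * Λ ^ 2)) * (16384 * G ^ 2 * mn + Real.sqrt 2 / 4 * ((2 : ℝ) ^ n)⁻¹) *
        (β * Λ / π * (10 + 50 * G * β / L)) := by gcongr
    _ = 512 / 3 * (27 / (8 * π ^ 2)) * A * (klScale klE0 n / (β * Λ ^ 2) * (β * Λ / π)) * (10 + 50 * G * β / L) *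
        (16384 * G ^ 2 * mn + Real.sqrt 2 / 4 * ((2 : ℝ) ^ n)⁻¹) := by ring
    _ ≤ 512 / 3 * (27 / (8 * π ^ 2)) * A * (16 * (Λ / klScale klE0 n) / π) * (10 + 50 * G * β / L) *
        (16384 * G ^ 2 * mn + Real.sqrt 2 / 4 * ((2 : ℝ) ^ n)⁻¹) := by gcongr
    _ ≤ 512 / 3 * (27 / (8 * π ^ 2)) * A * (16 * 1 / π) * (10 + 50 * G * β / L) *
        (16384 * G ^ 2 * mn + Real.sqrt 2 / 4 * ((2 : ℝ) ^ n)⁻¹) := by gcongr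
    _ = _ := by rw [hmn, hr]; ring

/-! ## §2 The crossed twin (appended, same session): `Wx_member_row_le_slots` reads `Wx_member_sum_le_twoShell` exactly as §1 reads the direct sum. -/

/-- **THE MEMBER CROSSED PH MASS IN THE SLOTS' CURRENCY ABOVE THE TRANSFER THRESHOLD** (twin of `Wd_member_row_le_slots`, reading
`Wx_member_sum_le_twoShell`; transfer `x + y − Qm`, constant `256/3`).  For `TwoShellFrameAreaAt A u`, `R.WF2`, `0 < U ≤ u R`, `μ ∈ klWindowC`,
`FrameOK R U N μ K`, `0 < β`, `n+1 ≤ j`, `π/(4β) ≤ Λₙ₊₁`, `t ∈ [0,1]`, `Gδ ≤ Λₙ₊₁`, `2Λₙ + Gδ ≤ klE0` and `Λₙ₊₁/8 ≤ G·|x+y−Qm|_𝕋`: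
`(Λₙ−Λₙ₊₁)((βL²)³)⁻¹·(member crossed mass) ≤ (256/3)(27/8π²)·A·(16/π)·(10 + 50Gβ/L)·(16384·G²·min(|x+y−Qm|_𝕋/Λₙ₊₁, Λₙ₊₁/|x+y−Qm|_𝕋) + (√2/4)·2⁻ⁿ)`. -/
theorem Wx_member_row_le_slots {L M : ℕ} [NeZero L] [NeZero M] (β μ : ℝ) (K : TrigPolyC4v) {A : ℝ} {u : RenConsts → ℝ} (h : TwoShellFrameAreaAt A u)
    (hA : 0 ≤ A) {R : RenConsts} (hR : R.WF2) {U : ℝ} (hU : 0 < U) (hUu : U ≤ u R) (hμ : μ ∈ klWindowC) {N : ℕ} (hK : FrameOK R U N μ K)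
    (hβ : 0 < β) (n : ℕ) {j : ℕ} (hj : n + 1 ≤ j) (hj'β : π / (4 * β) ≤ klScale klE0 (n + 1)) {t : ℝ} (ht : t ∈ Icc (0 : ℝ) 1)
    (hGδ : (4 + 8 / 3 * R.Gfr 1 * U ^ 2) * (2 * π / L) ≤ klScale klE0 (n + 1))
    (hE0 : 2 * klScale klE0 n + (4 + 8 / 3 * R.Gfr 1 * U ^ 2) * (2 * π / L) ≤ klE0) {Qm x y : TorusSite 2 L}
    (hlarge : klScale klE0 (n + 1) / 8 ≤ (4 + 8 / 3 * R.Gfr 1 * U ^ 2) * klTorusNorm L (x + y - Qm)) :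
    (klScale klE0 n - klScale klE0 (n + 1)) * ((β * (L : ℝ) ^ 2) ^ 3)⁻¹ *
      ∑ p : FreqMomentum L M, ∑ p' : FreqMomentum L M,
        (if matsubaraInt M p'.1 + matsubaraInt M (omega0 M) + matsubaraInt M (omega0 M) + 1 = matsubaraInt M p.1 ∧ p'.2 = p.2 + Qm - x - y then
          ‖((((softSymbolCompl L M β μ K (n + 1) j p + (hubbardCutoffWeightCT L M β μ K (klScale klE0 (n + 1)) p -
                hubbardCutoffWeightCT L M β μ K (klScale klE0 n + t * (klScale klE0 (n + 1) - klScale klE0 n)) p) : ℝ)) : ℂ) *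
                (((β * (L : ℝ) ^ 2 : ℝ) : ℂ) * propCT L M β μ K p)) *
              ((((deriv (fun Λ' : ℝ => hubbardCutoffWeightCT L M β μ K Λ' p') (klScale klE0 n + t * (klScale klE0 (n + 1) - klScale klE0 n)) : ℝ)) : ℂ) *
                (((β * (L : ℝ) ^ 2 : ℝ) : ℂ) * propCT L M β μ K p')) +
            ((((deriv (fun Λ' : ℝ => hubbardCutoffWeightCT L M β μ K Λ' p) (klScale klE0 n + t * (klScale klE0 (n + 1) - klScale klE0 n)) : ℝ)) : ℂ) *
                (((β * (L : ℝ) ^ 2 : ℝ) : ℂ) * propCT L M β μ K p)) *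
              ((((softSymbolCompl L M β μ K (n + 1) j p' + (hubbardCutoffWeightCT L M β μ K (klScale klE0 (n + 1)) p' -
                hubbardCutoffWeightCT L M β μ K (klScale klE0 n + t * (klScale klE0 (n + 1) - klScale klE0 n)) p') : ℝ)) : ℂ) *
                (((β * (L : ℝ) ^ 2 : ℝ) : ℂ) * propCT L M β μ K p'))‖
        else 0) ≤
      256 / 3 * (27 / (8 * π ^ 2)) * A * (16 / π) * (10 + 50 * (4 + 8 / 3 * R.Gfr 1 * U ^ 2) * β / L) *
        (16384 * (4 + 8 / 3 * R.Gfr 1 * U ^ 2) ^ 2 * min (klTorusNorm L (x + y - Qm) / klScale klE0 (n + 1)) (klScale klE0 (n + 1) / klTorusNorm L (x + y - Qm)) +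
          Real.sqrt 2 / 4 * ((2 : ℝ) ^ n)⁻¹) := by
  have hπ := Real.pi_pos
  have hL : (0 : ℝ) < L := by exact_mod_cast Nat.pos_of_ne_zero (NeZero.ne L)
  have hGfr : ∀ j, 0 ≤ R.Gfr j := hR.wf.2.2
  set G : ℝ := 4 + 8 / 3 * R.Gfr 1 * U ^ 2 with hG
  have hG4 : 4 ≤ G := by rw [hG]; nlinarith [hGfr 1, sq_nonneg U]
  have hG0 : 0 ≤ G := by linarith
  set Λ : ℝ := klScale klE0 n + t * (klScale klE0 (n + 1) - klScale klE0 n) with hΛdef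
  have hΛ : 0 < Λ := scaleAt_pos n ht
  obtain ⟨hΛlo, hΛhi⟩ := scaleAt_mem n ht
  rw [← hΛdef] at hΛlo hΛhi
  have hΛn := klth_klScale_pos n
  have hΛ1 := klth_klScale_pos (n + 1)
  have hsucc : klScale klE0 (n + 1) = klScale klE0 n / 4 := klth_klScale_succ n
  set r : ℝ := klTorusNorm L (x + y - Qm) with hr
  have hrpos : 0 < r := by
    by_contra h0; push Not at h0
    have : G * r ≤ 0 := mul_nonpos_of_nonneg_of_nonpos hG0 h0
    linarith
  set mn : ℝ := min (r / klScale klE0 (n + 1)) (klScale klE0 (n + 1) / r) with hmn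
  have hmn0 : 0 ≤ mn := le_min (by positivity) (by positivity)
  have hbound := Wx_member_sum_le_twoShell (L := L) (M := M) β μ K h hA hR hU hUu hμ hK hβ n hj ht hE0 hrpos (le_refl r)
  rw [← hΛdef] at hbound
  -- the two-shell factor at `(2Λ, 2Λₙ₊₁, κ = 64)`
  have hX := twoShell_factor_le_slots (Λ := 2 * Λ) (Λ₁ := 2 * klScale klE0 (n + 1)) (r := r) (e := G * (2 * π / L)) (κ := 64) (by positivity)
    (by linarith) (by rw [hsucc]; linarith) hG4 (by norm_num) (by linarith) (by linarith)
  have hX' : (2 * Λ + G * (2 * π / L)) / r + Real.sqrt (2 * Λ + G * (2 * π / L)) ≤ 16384 * G ^ 2 * mn + Real.sqrt 2 / 4 * ((2 : ℝ) ^ n)⁻¹ := by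
    refine hX.trans (add_le_add ?_ ?_)
    · have hmd := min_double_le hΛ1 hrpos
      rw [hmn]
      nlinarith [sq_nonneg G, mul_nonneg (mul_nonneg (by norm_num : (0:ℝ) ≤ 2 * 64 ^ 2) (sq_nonneg G)) (le_min (by positivity : 0 ≤ r / (2 * klScale klE0 (n + 1))) (by positivity : 0 ≤ 2 * klScale klE0 (n + 1) / r))]
    · have h4 : Real.sqrt (2 * (2 * Λ)) ≤ Real.sqrt (2 * (2 * klScale klE0 n)) := Real.sqrt_le_sqrt (by linarith)
      have e : Real.sqrt (2 * (2 * klScale klE0 n)) = Real.sqrt 2 * Real.sqrt (2 * klScale klE0 n) := by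
        rw [← Real.sqrt_mul (by norm_num : (0:ℝ) ≤ 2)]
      rw [e, sqrt_two_mul_klScale_eq n] at h4
      linarith
  have hB := bracket_le (Λ' := Λ) hβ hL hG0 (hj'β.trans hΛlo)
  have hXnn : 0 ≤ (2 * Λ + G * (2 * π / L)) / r + Real.sqrt (2 * Λ + G * (2 * π / L)) := by positivity
  have hBnn : 0 ≤ β * Λ / π * (10 + 2 * G * β / L) + 12 * G * β / L := by positivity
  have hpre : 0 ≤ (klScale klE0 n - klScale klE0 (n + 1)) * ((β * (L : ℝ) ^ 2) ^ 3)⁻¹ := by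
    rw [hsucc]; have : 0 ≤ klScale klE0 n - klScale klE0 n / 4 := by linarith
    positivity
  refine (mul_le_mul_of_nonneg_left hbound hpre).trans ?_
  rw [hsucc, prefactor_eq hβ hL hΛ]
  have hratio : klScale klE0 n / (β * Λ ^ 2) * (β * Λ / π) ≤ 16 * (Λ / klScale klE0 n) / π :=
    ratio_le_sixteen hΛn hΛ hβ hΛ (by rw [hsucc] at hΛlo; exact hΛlo)
  have hq1 : Λ / klScale klE0 n ≤ 1 := by rw [div_le_one hΛn]; exact hΛhi
  calc 256 / 3 * (27 / (8 * π ^ 2)) * A * (klScale klE0 n / (β * Λ ^ 2)) *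
        ((2 * Λ + G * (2 * π / L)) / r + Real.sqrt (2 * Λ + G * (2 * π / L))) *
        (β * Λ / π * (10 + 2 * G * β / L) + 12 * G * β / L)
      ≤ 256 / 3 * (27 / (8 * π ^ 2)) * A * (klScale klE0 n / (β * Λ ^ 2)) * (16384 * G ^ 2 * mn + Real.sqrt 2 / 4 * ((2 : ℝ) ^ n)⁻¹) *
        (β * Λ / π * (10 + 50 * G * β / L)) := by gcongr
    _ = 256 / 3 * (27 / (8 * π ^ 2)) * A * (klScale klE0 n / (β * Λ ^ 2) * (β * Λ / π)) * (10 + 50 * G * β / L) *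
        (16384 * G ^ 2 * mn + Real.sqrt 2 / 4 * ((2 : ℝ) ^ n)⁻¹) := by ring
    _ ≤ 256 / 3 * (27 / (8 * π ^ 2)) * A * (16 * (Λ / klScale klE0 n) / π) * (10 + 50 * G * β / L) *
        (16384 * G ^ 2 * mn + Real.sqrt 2 / 4 * ((2 : ℝ) ^ n)⁻¹) := by gcongr
    _ ≤ 256 / 3 * (27 / (8 * π ^ 2)) * A * (16 * 1 / π) * (10 + 50 * G * β / L) *
        (16384 * G ^ 2 * mn + Real.sqrt 2 / 4 * ((2 : ℝ) ^ n)⁻¹) := by gcongr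
    _ = _ := by rw [hmn, hr]; ring

end Summit.HubbardSuperconductivity.HubbardSuperconductivity.Theorems.KLRegimeSplit

end
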